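import Mathlib
import HarnessLib
import Summits.KontsevichZagierPeriods.Zeta5Search.Denom.TwoTaleD1Levels
import Summits.KontsevichZagierPeriods.Zeta5Search.Denom.TwoTaleD1DigitTables
import Summits.KontsevichZagierPeriods.Zeta5Search.TwoTaleOmega.OmegaLadder

/-!
# TwoTaleD1Inclusion — the `InclusionD1` input of rung D1 = L(1/3) DISCHARGED: `Φₙ ∣ D₂₂ₙD₂₃ₙ qₙ`, `Φₙ⁻¹D₂₂ₙD₂₃ₙ pₙ ∈ ℤ`

HONEST FRAMING: systematic search; no irrationality claim unless certified.

OUR theorem (Summit side), fam-denom (pub-zeta5), FAMILY.md §6 D24; `p`-adic/denominator bookkeeping only.  Rung D1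
of the denominator ladder is Zudilin's two-tale construction [Zudilin2014ZetaTwo] at the cone point
`a = (19,16,13,22)·n + 1`, `b = (1, 3n+1, 6n+1, 38n+2)` with partner `â = (47n+2; 16n+1, 19n+1, 22n+1)`,
`b̂ = (22n+2; 9n+1, 35n+2, 38n+2)` (`TwoTaleD1Forms`).  Its saving product `Φₙ` (`TwoTaleD1Saving`, rate
`S ∈ [23.20999, 23.21011]`) counts the primes `48√n < p ≤ 22n` with digit `ν(n/p) = max(φ, φ̂) ≥ 1` (once) / `= 2`
(twice).  This file proves the inclusion **hypothesis-free**: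

* `bmissD1` — the two-tale coincidence `q(a,b) = −q̂(â,b̂)`, `p(a,b) = −p̂(â,b̂)` for every `n ≥ 1`, which is
  fam-tele's kernel theorem `TwoTaleOmega.bmiss_D1` ([Zu14, §5]'s identity (bmiss) on the region `Ω`; D1 is the ladder
  point `(Q,P) = (3n,n)`), transported to the `TwoTaleD1Forms` names;
* `levelsD1` — for every counted prime the level divisibilities `p^ℓ ∣ qₙ`, `p^ℓ ∣ D₂₂ₙD₂₃ₙ pₙ` from the CHECKED DIGIT
  TABLES (`TwoTaleD1DigitTables.coverD1_sound`: 106 cells, Lemma 7 / Lemma 8 row by row, `decide +kernel`);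
* **`inclusionD1_holds : TwoTaleD1Forms.InclusionD1`** via `TwoTaleD1Levels.inclusionD1_of_unpacked`;
* the rung's measure theorem with the inclusion discharged: **`zetaTwo_exponent_le_D1`** —
  `DecayD1 42.33437 → CoeffRateD1 C₁ → 0 < C₁ ≤ 60.808 → ExponentLE (zetaValue 2) 5.0205`.  The two remaining inputs
  (tale-1 decay constant `C₀ = 42.33438…`, coefficient growth `C₁ = 60.80787…`) are P1's saddle files
  (`TwoTaleD1Measure`, Phase 2); until they land **5.0205 is a DESIGN value**, and in any case it concerns the
  known-irrational `ζ(2)`: nothing here bears on `ζ(5)`.  0 sorry; standard axioms.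
References: W. Zudilin, arXiv:1310.1526 [Zudilin2014ZetaTwo], Lemmas 7–8, §5.
-/

namespace Summit.KontsevichZagierPeriods.Zeta5Search.Denom.TwoTaleD1Inclusion

open Literature.NumberTheory.Transcendental
open Literature.NumberTheory.Irrationality.Zudilin2014
open Summit.KontsevichZagierPeriods.Zeta5Search.Denom.TwoTaleD1Saving (ivlD1)
open Summit.KontsevichZagierPeriods.Zeta5Search.Denom.TwoTaleD1Forms
open Summit.KontsevichZagierPeriods.Zeta5Search.Denom.TwoTaleD1Levels
open Summit.KontsevichZagierPeriods.Zeta5Search.Denom.TwoTaleD1DigitTables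
open Summit.KontsevichZagierPeriods.Zeta5Search.TwoTaleOmega

/-! ### The two inputs of the level divisibilities -/

/-- **(bmiss) at D1** in the `TwoTaleD1Forms` names: `q(a,b) = −q̂(â,b̂)` and `p(a,b) = −p̂(â,b̂)` for `n ≥ 1`
(fam-tele's `TwoTaleOmega.bmiss_D1` + `D1_tales`). -/
theorem bmissD1 {n : ℕ} (hn : 1 ≤ n) :
    formQ (aD1 n) (bD1 n) = -formQT (aTD1 n) (bTD1 n) ∧ formP (aD1 n) (bD1 n) = -formPT (aTD1 n) (bTD1 n) := by
  have h := bmiss_D1 n hn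
  obtain ⟨h1, h2, h3, h4⟩ := D1_tales n
  unfold Pt.Bmiss at h
  rw [h1, h2, h3, h4] at h
  have e1 : aD1 n = ![19 * (n : ℤ) + 1, 16 * n + 1, 13 * n + 1, 22 * n + 1] := by
    ext i; fin_cases i <;> simp
  have e2 : bD1 n = ![1, 3 * (n : ℤ) + 1, 6 * n + 1, 38 * n + 2] := by
    ext i; fin_cases i <;> simp
  have e3 : aTD1 n = ![47 * (n : ℤ) + 2, 16 * n + 1, 19 * n + 1, 22 * n + 1] := by
    ext i; fin_cases i <;> simp
  have e4 : bTD1 n = ![22 * (n : ℤ) + 2, 9 * n + 1, 35 * n + 2, 38 * n + 2] := by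
    ext i; fin_cases i <;> simp
  rw [e1, e2, e3, e4]
  exact h

/-- **`D₂₂ₙD₂₃ₙ pₙ` is the integer `formPZ (aD1 n) (bD1 n) (22n) (23n)`** (Prop. 1 with `M₁ = 22n ≥ aⱼ − bⱼ, b₄ − a₂* − 1`
and `M₂ = 23n ≥ d + 1, b₄ − a₂* − 1`). -/
theorem lcmNormaliserD1_mul_formPD1 {n : ℕ} (hn : 1 ≤ n) :
    ((lcmNormaliserD1 n : ℕ) : ℚ) * formPD1 n = (formPZ (aD1 n) (bD1 n) (22 * n) (23 * n) : ℚ) := by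
  have hc : ∀ j : Fin 4, j ≠ 3 → (aD1 n j - bD1 n j).toNat ≤ 22 * n := fun j hj => by
    have h := sideD1_M n j j hj
    rwa [aOne_slopeD1, bOne_betaD1] at h
  have hK := sideD1_K n
  have hd := sideD1_d hn
  rw [aOne_slopeD1, bOne_betaD1] at hK hd
  rw [lcmNormaliserD1, formPD1, Nat.cast_mul]
  exact formP_eq_cast (admissibleD1 hn) hc hK.1 hK.2 hd

/-! ### Level divisibilities from the digit tables -/

/-- **Level divisibilities at D1** (`n ≥ 1`): for a prime `p ≤ 22n` with `2304 n < p²` counted in `ivlD1 i`,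
`p ∣ qₙ`, `p ∣ D₂₂ₙD₂₃ₙpₙ` (`i < 15`) and `p² ∣ qₙ`, `p² ∣ D₂₂ₙD₂₃ₙpₙ` (`15 ≤ i < 32`) — the digit tables
(`coverD1_sound`) fed with (bmiss) (`bmissD1`). -/
theorem levelsD1 {n : ℕ} (hn : 1 ≤ n) :
    (∀ i < 15, ∀ p : ℕ, p.Prime → p ≤ 22 * n → 2304 * n < p ^ 2 →
      (ivlD1 i).1 ≤ Int.fract ((n : ℝ) / p) → Int.fract ((n : ℝ) / p) < (ivlD1 i).2 →
        (p : ℤ) ∣ formQZ (aD1 n) (bD1 n) ∧ (p : ℤ) ∣ formPZ (aD1 n) (bD1 n) (22 * n) (23 * n)) ∧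
    (∀ i, 15 ≤ i → i < 32 → ∀ p : ℕ, p.Prime → p ≤ 22 * n → 2304 * n < p ^ 2 →
      (ivlD1 i).1 ≤ Int.fract ((n : ℝ) / p) → Int.fract ((n : ℝ) / p) < (ivlD1 i).2 →
        (p : ℤ) ^ 2 ∣ formQZ (aD1 n) (bD1 n) ∧ (p : ℤ) ^ 2 ∣ formPZ (aD1 n) (bD1 n) (22 * n) (23 * n)) := by
  obtain ⟨hbq, hbp⟩ := bmissD1 hn
  refine ⟨fun i hi p hp hple hsq hu hv => ?_, fun i hi hi' p hp hple hsq hu hv => ?_⟩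
  · have h := coverD1_sound (by omega) hn hp hple hsq hbq hbp hu hv
    rwa [if_pos hi, pow_one] at h
  · have h := coverD1_sound hi' hn hp hple hsq hbq hbp hu hv
    rwa [if_neg (not_lt.2 hi)] at h

/-! ### The inclusion, hypothesis-free -/

/-- **`InclusionD1` holds**: `Φₙ ∣ D₂₂ₙD₂₃ₙ qₙ` and `Φₙ⁻¹ D₂₂ₙD₂₃ₙ pₙ ∈ ℤ` for every `n ≥ 1`. -/
theorem inclusionD1_holds : InclusionD1 :=
  inclusionD1_of_unpacked
    (fun _ hn => ⟨fun i hi p hp hple hsq hu hv => ((levelsD1 hn).1 i hi p hp hple hsq hu hv).1,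
      fun i hi hi' p hp hple hsq hu hv => ((levelsD1 hn).2 i hi hi' p hp hple hsq hu hv).1⟩)
    fun n hn => ⟨formPZ (aD1 n) (bD1 n) (22 * n) (23 * n), lcmNormaliserD1_mul_formPD1 hn,
      fun i hi p hp hple hsq hu hv => ((levelsD1 hn).1 i hi p hp hple hsq hu hv).2,
      fun i hi hi' p hp hple hsq hu hv => ((levelsD1 hn).2 i hi hi' p hp hple hsq hu hv).2⟩

/-! ### The rung's measure theorem with the inclusion discharged -/

/-- **Rung D1 from the two tale-1 inputs (PROVED implication; `InclusionD1` discharged above):**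
`DecayD1 42.33437 → CoeffRateD1 C₁ → 0 < C₁ ≤ 60.808 → μ(ζ(2)) ≤ 5.0205` (`ExponentLE`).  The inputs are P1's
Phase-2 saddle theorems; 5.0205 stays a DESIGN value until they land; `ζ(2)` is known to be irrational — no claim
about `ζ(5)`. -/
theorem zetaTwo_exponent_le_D1 {C₁ : ℝ} (hD : DecayD1 42.33437) (hC : CoeffRateD1 C₁) (hC₀ : 0 < C₁)
    (hC₁ : C₁ ≤ 60.808) : ExponentLE (zetaValue 2) 5.0205 :=
  zetaTwo_exponent_le_D1_of_inputs inclusionD1_holds hD hC hC₀ hC₁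

/-- Loose-constant variant: `DecayD1 42.3 → CoeffRateD1 C₁ → 0 < C₁ ≤ 60.9 → μ(ζ(2)) ≤ 5.034`. -/
theorem zetaTwo_exponent_le_D1_loose' {C₁ : ℝ} (hD : DecayD1 42.3) (hC : CoeffRateD1 C₁) (hC₀ : 0 < C₁)
    (hC₁ : C₁ ≤ 60.9) : ExponentLE (zetaValue 2) 5.034 :=
  zetaTwo_exponent_le_D1_loose inclusionD1_holds hD hC hC₀ hC₁

end Summit.KontsevichZagierPeriods.Zeta5Search.Denom.TwoTaleD1Inclusion
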